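import Literature.MathematicalPhysics.QuantumLattice.FlowLiebRobinsonProofs
import HarnessLib

/-!
# Lieb–Robinson bounds for flows of quasi-local generators: size-weighted local norms

Eighteenth file of the formalisation of the Michalakis–Zwolak stability theorem (hubbard.S19),
the form of the flow Lieb–Robinson bound actually used for the spectral-flow generator
`D(s) = Σ_u Σ_ℓ Δ_{u,ℓ}(s)` of MZ13 §5.2 (terms on balls of all radii, norms decaying
superpolynomially in the radius). Compared with `FlowQuasiLocalityProofs`, the cap `#Z ≤ V` on
the size of the short-range terms is replaced by the size-weighted local norm
`Σ_{Z ∋ x} #Z ‖Ψ_s Z‖ ≤ J` (the analogue of the `F`-norm of Bachmann–Michalakis–Nachtergaele–Sims,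
arXiv:1102.0842 Thm 4.6, for this iteration), so that the light-cone velocity `2J` does not grow
with the splitting scale:

* `norm_comm_flow_le_iterate_weighted` — the two-scale iterated inequality
  `‖[α_s(A), B]‖ ≤ 2‖A‖‖B‖ (𝟙[δX = 0] + #X (S_N(δX, s) + κ S_N(1, s)))`, `c = 2J`;
* `norm_comm_flow_le_exp_weighted` —
  `‖[α_s(A), B]‖ ≤ 2‖A‖‖B‖ #X (exp(−μ δX + 2e^μ Js) + κ exp(2Js))` on `[0, T]`.

No definitions, no named facts (theorems only). [folklore]
-/

noncomputable section

open Matrix Complex Set Filter MeasureTheory Topology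
open scoped Nat
open scoped Matrix Matrix.Norms.L2Operator Topology

namespace Literature.MathematicalPhysics.QuantumLattice

section Lattice

open Finset

variable {Λ : Type*} [Fintype Λ] [DecidableEq Λ] {q : ℕ}

/-! ### Quasi-local generators, weighted local norms: iteration without a size cap -/

set_option maxHeartbeats 1000000 in
/-- **The iterated inequality for flows of quasi-local generators (weighted two-scale form).**
As in `norm_comm_flow_le_iterate`, but only the terms satisfying `R` (the short-range part) are graded
and iterated; the remaining (long-range) terms are merely bounded, through
`Σ_{Z ∋ x, ¬R Z} ‖Ψ_s Z‖ ≤ κ J`. The price is the additional ungraded contribution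
`κ Σ_{n=1}^{N} (cs)ⁿ/n!` (plus remainder):
`‖[α_s(A), B]‖ ≤ 2‖A‖‖B‖ (𝟙[δX = 0] + #X (S_N(δX, s) + κ S_N(1, s)))`,
`S_N(d, s) = Σ_{n=max(1,d)}^{N} (cs)ⁿ/n! + (cs)^{N+1}/(N+1)!`, `c = 2J`, where now `J` bounds the
SIZE-WEIGHTED local norm `Σ_{Z ∋ x} #Z ‖Ψ_s Z‖` (no cap on the size of the terms is needed: the
weight replaces the factor `#Z/V` of the finite-range iteration). [folklore] -/
theorem norm_comm_flow_le_iterate_weighted {Ψ : ℝ → Interaction Λ q} (hΨ : ∀ s, (Ψ s).IsLocal)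
    {T : ℝ} (hΨc : ∀ Z, ContinuousOn (fun s => Ψ s Z) (Icc 0 T)) {U : ℝ → Op Λ q} (hU0 : U 0 = 1)
    (hU : ∀ s ∈ Icc 0 T,
      HasDerivWithinAt U (((I : ℂ) • localHamiltonian (Ψ s) univ) * U s) (Icc 0 T) s)
    (hU1 : ∀ s ∈ Icc 0 T, (U s)ᴴ * U s = 1) (hU2 : ∀ s ∈ Icc 0 T, U s * (U s)ᴴ = 1)
    {R : Finset Λ → Prop} [DecidablePred R]
    {Y : Finset Λ} {B : Op Λ q} (hB : IsSupportedOn B Y) (δ : Finset Λ → ℕ)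
    (hδY : ∀ Z, 0 < δ Z → Disjoint Z Y) (hδ : ∀ Z Z', R Z' → ¬ Disjoint Z' Z → δ Z ≤ δ Z' + 1)
    {J : ℝ} (hJ0 : 0 ≤ J)
    (hJ : ∀ s ∈ Icc 0 T, ∀ x : Λ, ∑ Z ∈ univ.filter (fun Z : Finset Λ => x ∈ Z),
      (#Z : ℝ) * ‖Ψ s Z‖ ≤ J)
    {κ : ℝ} (hκ : 0 ≤ κ)
    (hJ' : ∀ s ∈ Icc 0 T, ∀ x : Λ, ∑ Z ∈ univ.filter (fun Z : Finset Λ => x ∈ Z),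
      ‖(if R Z then (0 : Op Λ q) else Ψ s Z)‖ ≤ κ * J) (N : ℕ) :
    ∀ (X : Finset Λ) (A : Op Λ q), IsSupportedOn A X → ∀ s ∈ Icc 0 T,
      ‖(U s)ᴴ * A * U s * B - B * ((U s)ᴴ * A * U s)‖ ≤
        2 * ‖A‖ * ‖B‖ * ((if δ X = 0 then 1 else 0) + (#X : ℝ) *
          ((∑ n ∈ Finset.Icc (max 1 (δ X)) N, (2 * J * s) ^ n / n ! +
            (2 * J * s) ^ (N + 1) / (N + 1)!) +
           κ * (∑ n ∈ Finset.Icc (max 1 1) N, (2 * J * s) ^ n / n ! +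
            (2 * J * s) ^ (N + 1) / (N + 1)!))) := by
  have hc0 : 0 ≤ 2 * J := by positivity
  have hUu : ∀ s ∈ Icc 0 T, U s ∈ unitary (Op Λ q) := fun s hs =>
    Matrix.mem_unitaryGroup_iff'.mpr (hU1 s hs)
  have hUu' : ∀ s ∈ Icc 0 T, (U s)ᴴ ∈ unitary (Op Λ q) := fun s hs => by
    rw [← star_eq_conjTranspose]; exact Unitary.star_mem (hUu s hs)
  have hnormα : ∀ s ∈ Icc 0 T, ∀ M : Op Λ q, ‖(U s)ᴴ * M * U s‖ = ‖M‖ := fun s hs M =>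
    norm_unitary_mul_mul_unitary (hUu' s hs) (hUu s hs) M
  -- the initial commutator
  have hinit : ∀ (X : Finset Λ) (A : Op Λ q), IsSupportedOn A X →
      ‖A * B - B * A‖ ≤ 2 * ‖A‖ * ‖B‖ * (if δ X = 0 then 1 else 0) := by
    intro X A hA
    by_cases h0 : δ X = 0
    · rw [if_pos h0, mul_one]; exact norm_commutator_le A B
    · rw [if_neg h0, mul_zero]
      have hdisj : Disjoint X Y := hδY X (Nat.pos_of_ne_zero h0)
      rw [(commute_of_disjoint_holds hA hB hdisj).eq, sub_self, norm_zero]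
  -- the terms touching `X`: size-weighted, plain, and the long-range ones
  have hnw : ∀ s (Z : Finset Λ), ‖(((#Z : ℕ) : ℂ) • Ψ s Z)‖ = (#Z : ℝ) * ‖Ψ s Z‖ := fun s Z => by
    rw [norm_smul, Complex.norm_natCast]
  have hsumXw : ∀ s ∈ Icc 0 T, ∀ X : Finset Λ,
      ∑ Z ∈ univ.filter (fun Z : Finset Λ => ¬ Disjoint Z X), (#Z : ℝ) * ‖Ψ s Z‖ ≤ #X * J := by
    intro s hs X
    have h := sum_norm_filter_not_disjoint_le (Φ := fun Z => (((#Z : ℕ) : ℂ) • Ψ s Z))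
      (fun x => by simpa only [hnw] using hJ s hs x) X
    simpa only [hnw] using h
  have hsumX : ∀ s ∈ Icc 0 T, ∀ X : Finset Λ,
      ∑ Z ∈ univ.filter (fun Z : Finset Λ => ¬ Disjoint Z X), ‖Ψ s Z‖ ≤ #X * J := by
    intro s hs X
    refine le_trans (sum_le_sum fun Z hZ => ?_) (hsumXw s hs X)
    simp only [Finset.mem_filter, Finset.mem_univ, true_and] at hZ
    have hne : Z.Nonempty := by
      by_contra h
      rw [Finset.not_nonempty_iff_eq_empty] at h
      exact hZ (h ▸ Finset.disjoint_empty_left X)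
    have h1 : (1 : ℝ) ≤ #Z := by exact_mod_cast hne.card_pos
    exact le_mul_of_one_le_left (norm_nonneg _) h1
  have hsumX' : ∀ s ∈ Icc 0 T, ∀ X : Finset Λ,
      ∑ Z ∈ univ.filter (fun Z : Finset Λ => ¬ Disjoint Z X),
        ‖(if R Z then (0 : Op Λ q) else Ψ s Z)‖ ≤ #X * (κ * J) :=
    fun s hs X => sum_norm_filter_not_disjoint_le (Φ := fun Z => if R Z then 0 else Ψ s Z)
      (hJ' s hs) X
  -- continuity of the integrand on the interval
  have hUc : ContinuousOn U (Icc 0 T) := fun s hs => (hU s hs).continuousWithinAt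
  have hUHc : ContinuousOn (fun s => (U s)ᴴ) (Icc 0 T) := fun s hs =>
    (hasDerivWithinAt_conjTranspose (hU s hs)).continuousWithinAt
  have hcontsum : ∀ X : Finset Λ, ContinuousOn (fun u : ℝ =>
      ∑ Z ∈ univ.filter (fun Z : Finset Λ => ¬ Disjoint Z X),
        ‖(U u)ᴴ * Ψ u Z * U u * B - B * ((U u)ᴴ * Ψ u Z * U u)‖) (Icc 0 T) := fun X => by
    refine continuousOn_finsetSum _ fun Z _ => ?_
    have hZc : ContinuousOn (fun s => (U s)ᴴ * Ψ s Z * U s) (Icc 0 T) := (hUHc.mul (hΨc Z)).mul hUc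
    exact ((hZc.mul continuousOn_const).sub (continuousOn_const.mul hZc)).norm
  have hsubI : ∀ s ∈ Icc 0 T, uIcc 0 s ⊆ Icc 0 T := fun s hs => by
    rw [uIcc_of_le hs.1]; exact Icc_subset_Icc le_rfl hs.2
  have hmax11 : max 1 1 = 1 := max_self 1
  induction N with
  | zero =>
    intro X A hA s hs
    have hs0 : (0 : ℝ) ≤ s := hs.1
    have hcore := norm_comm_flow_le_integral_sum hΨ hΨc hU0 hU hU1 hU2 hA B hs
    -- trivial bound on the integrand
    have hint : ∫ u in (0:ℝ)..s, ∑ Z ∈ univ.filter (fun Z : Finset Λ => ¬ Disjoint Z X),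
        ‖(U u)ᴴ * Ψ u Z * U u * B - B * ((U u)ᴴ * Ψ u Z * U u)‖ ≤
        ∫ u in (0:ℝ)..s, 2 * ‖B‖ * (#X * J) := by
      refine intervalIntegral.integral_mono_on hs0 (((hcontsum X).mono (hsubI s hs)).intervalIntegrable)
        intervalIntegrable_const fun u hu => ?_
      have hu' : u ∈ Icc 0 T := ⟨hu.1, hu.2.trans hs.2⟩
      calc ∑ Z ∈ univ.filter (fun Z : Finset Λ => ¬ Disjoint Z X),
            ‖(U u)ᴴ * Ψ u Z * U u * B - B * ((U u)ᴴ * Ψ u Z * U u)‖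
          ≤ ∑ Z ∈ univ.filter (fun Z : Finset Λ => ¬ Disjoint Z X), 2 * ‖B‖ * ‖Ψ u Z‖ := by
            refine sum_le_sum fun Z _ => ?_
            calc _ ≤ 2 * ‖(U u)ᴴ * Ψ u Z * U u‖ * ‖B‖ := norm_commutator_le _ _
              _ = 2 * ‖B‖ * ‖Ψ u Z‖ := by rw [hnormα u hu']; ring
        _ = 2 * ‖B‖ * ∑ Z ∈ univ.filter (fun Z : Finset Λ => ¬ Disjoint Z X), ‖Ψ u Z‖ := by
            rw [mul_sum]
        _ ≤ 2 * ‖B‖ * (#X * J) := mul_le_mul_of_nonneg_left (hsumX u hu' X) (by positivity)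
    rw [intervalIntegral.integral_const, sub_zero, smul_eq_mul] at hint
    have h1 := hinit X A hA
    have hIcc : Finset.Icc (max 1 (δ X)) 0 = ∅ := by
      ext n
      simp only [Finset.mem_Icc, Finset.notMem_empty, iff_false, not_and, not_le]
      omega
    have hIcc1 : Finset.Icc (max 1 1) 0 = ∅ := by
      ext n
      simp only [Finset.mem_Icc, Finset.notMem_empty, iff_false, not_and, not_le]
      omega
    simp only [hIcc, hIcc1, sum_empty, zero_add, Nat.factorial_one, Nat.cast_one, div_one, pow_one]
    have hXV : (0 : ℝ) ≤ #X := Nat.cast_nonneg _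
    have hκcs : 0 ≤ κ * (2 * J * s) := mul_nonneg hκ (mul_nonneg hc0 hs0)
    calc _ ≤ ‖A * B - B * A‖ + 2 * ‖A‖ * (s * (2 * ‖B‖ * (#X * J))) :=
          hcore.trans (add_le_add le_rfl (mul_le_mul_of_nonneg_left hint (by positivity)))
      _ ≤ 2 * ‖A‖ * ‖B‖ * (if δ X = 0 then 1 else 0) + 2 * ‖A‖ * (s * (2 * ‖B‖ * (#X * J))) :=
          add_le_add h1 le_rfl
      _ = 2 * ‖A‖ * ‖B‖ * ((if δ X = 0 then 1 else 0) + (#X : ℝ) * (2 * J * s)) := by ring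
      _ ≤ _ := by
          refine mul_le_mul_of_nonneg_left (add_le_add le_rfl
            (mul_le_mul_of_nonneg_left ?_ hXV)) (by positivity)
          linarith
  | succ N ih =>
    intro X A hA s hs
    have hs0 : (0 : ℝ) ≤ s := hs.1
    have hcore := norm_comm_flow_le_integral_sum hΨ hΨc hU0 hU hU1 hU2 hA B hs
    set c : ℝ := 2 * J with hc
    set a : ℕ := max 1 (δ X - 1) with ha
    -- the partial exponential sums, as opaque functions of the time
    obtain ⟨Sa, hSa⟩ : ∃ f : ℝ → ℝ, f = fun u =>
        ∑ n ∈ Finset.Icc a N, (c * u) ^ n / n ! + (c * u) ^ (N + 1) / (N + 1)! := ⟨_, rfl⟩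
    obtain ⟨S1, hS1⟩ : ∃ f : ℝ → ℝ, f = fun u =>
        ∑ n ∈ Finset.Icc 1 N, (c * u) ^ n / n ! + (c * u) ^ (N + 1) / (N + 1)! := ⟨_, rfl⟩
    have hSa0 : ∀ u, 0 ≤ u → 0 ≤ Sa u := fun u hu => by
      rw [hSa]; have : 0 ≤ c * u := mul_nonneg hc0 hu; positivity
    have hS10 : ∀ u, 0 ≤ u → 0 ≤ S1 u := fun u hu => by
      rw [hS1]; have : 0 ≤ c * u := mul_nonneg hc0 hu; positivity
    have hSac : Continuous Sa := by rw [hSa]; fun_prop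
    have hS1c : Continuous S1 := by rw [hS1]; fun_prop
    set ι : ℝ := if δ X ≤ 1 then 1 else 0 with hι
    have hι0 : 0 ≤ ι := by rw [hι]; split_ifs <;> norm_num
    have h2B : 0 ≤ 2 * ‖B‖ := by positivity
    -- the induction hypothesis at a short-range term `Z` (weight `#Z`)
    have hterm : ∀ u ∈ Icc 0 s, ∀ Z ∈ univ.filter (fun Z : Finset Λ => ¬ Disjoint Z X), R Z →
        ‖(U u)ᴴ * Ψ u Z * U u * B - B * ((U u)ᴴ * Ψ u Z * U u)‖ ≤
          (#Z : ℝ) * ‖Ψ u Z‖ * (2 * ‖B‖ * (ι + Sa u + κ * S1 u)) := by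
      intro u hu Z hZ hRZ
      have hu' : u ∈ Icc 0 T := ⟨hu.1, hu.2.trans hs.2⟩
      simp only [Finset.mem_filter, Finset.mem_univ, true_and] at hZ
      have hIH := ih Z (Ψ u Z) ((hΨ u).isSupportedOn Z) u hu'
      have hδZ : δ X ≤ δ Z + 1 := hδ X Z hRZ hZ
      have hne : Z.Nonempty := by
        by_contra h
        rw [Finset.not_nonempty_iff_eq_empty] at h
        exact hZ (h ▸ Finset.disjoint_empty_left X)
      have hZ1 : (1 : ℝ) ≤ #Z := by exact_mod_cast hne.card_pos
      have hZ0 : (0 : ℝ) ≤ #Z := Nat.cast_nonneg _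
      have hcu : 0 ≤ c * u := mul_nonneg hc0 hu.1
      -- the two sums at `Z`, compared with `Sa u` and `S1 u`
      have hSZ : ∑ n ∈ Finset.Icc (max 1 (δ Z)) N, (c * u) ^ n / n ! + (c * u) ^ (N + 1) / (N + 1)!
          ≤ Sa u := by
        rw [hSa]
        have hsub : Finset.Icc (max 1 (δ Z)) N ⊆ Finset.Icc a N :=
          Finset.Icc_subset_Icc (by omega) le_rfl
        exact add_le_add (sum_le_sum_of_subset_of_nonneg hsub fun n _ _ => by positivity) le_rfl
      have hS1u : ∑ n ∈ Finset.Icc (max 1 1) N, (c * u) ^ n / n ! + (c * u) ^ (N + 1) / (N + 1)!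
          = S1 u := by rw [hS1, hmax11]
      have hind : (if δ Z = 0 then (1:ℝ) else 0) ≤ ι := by
        rw [hι]
        by_cases hZ0' : δ Z = 0
        · rw [if_pos hZ0', if_pos (by omega)]
        · rw [if_neg hZ0']
          split_ifs <;> norm_num
      rw [hS1u] at hIH
      refine hIH.trans ?_
      have hkey : (if δ Z = 0 then (1:ℝ) else 0) + (#Z : ℝ) *
          ((∑ n ∈ Finset.Icc (max 1 (δ Z)) N, (c * u) ^ n / n ! + (c * u) ^ (N + 1) / (N + 1)!) +
            κ * S1 u) ≤ (#Z : ℝ) * (ι + Sa u + κ * S1 u) := by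
        have h1 : (if δ Z = 0 then (1:ℝ) else 0) ≤ (#Z : ℝ) * ι :=
          hind.trans (le_mul_of_one_le_left hι0 hZ1)
        have h2 : (#Z : ℝ) * (∑ n ∈ Finset.Icc (max 1 (δ Z)) N, (c * u) ^ n / n ! +
            (c * u) ^ (N + 1) / (N + 1)!) ≤ (#Z : ℝ) * Sa u := mul_le_mul_of_nonneg_left hSZ hZ0
        have e1 : (#Z : ℝ) * ((∑ n ∈ Finset.Icc (max 1 (δ Z)) N, (c * u) ^ n / n ! +
            (c * u) ^ (N + 1) / (N + 1)!) + κ * S1 u) =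
            (#Z : ℝ) * (∑ n ∈ Finset.Icc (max 1 (δ Z)) N, (c * u) ^ n / n ! +
            (c * u) ^ (N + 1) / (N + 1)!) + κ * ((#Z : ℝ) * S1 u) := by ring
        have e2 : (#Z : ℝ) * (ι + Sa u + κ * S1 u) =
            (#Z : ℝ) * ι + (#Z : ℝ) * Sa u + κ * ((#Z : ℝ) * S1 u) := by ring
        rw [e1, e2]
        linarith
      calc 2 * ‖Ψ u Z‖ * ‖B‖ * ((if δ Z = 0 then (1:ℝ) else 0) + (#Z : ℝ) *
            ((∑ n ∈ Finset.Icc (max 1 (δ Z)) N, (c * u) ^ n / n ! + (c * u) ^ (N + 1) / (N + 1)!) +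
              κ * S1 u))
          ≤ 2 * ‖Ψ u Z‖ * ‖B‖ * ((#Z : ℝ) * (ι + Sa u + κ * S1 u)) :=
            mul_le_mul_of_nonneg_left hkey (by positivity)
        _ = (#Z : ℝ) * ‖Ψ u Z‖ * (2 * ‖B‖ * (ι + Sa u + κ * S1 u)) := by ring
    -- the integrand bound: short-range terms by `hterm`, long-range terms by `2‖B‖‖Ψ Z‖`
    have hFc : Continuous fun u => 2 * ‖B‖ * (ι + Sa u) + κ * (2 * ‖B‖ * (1 + S1 u)) := by
      fun_prop
    have hint : ∫ u in (0:ℝ)..s, ∑ Z ∈ univ.filter (fun Z : Finset Λ => ¬ Disjoint Z X),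
        ‖(U u)ᴴ * Ψ u Z * U u * B - B * ((U u)ᴴ * Ψ u Z * U u)‖ ≤
        ∫ u in (0:ℝ)..s, (#X * J) * (2 * ‖B‖ * (ι + Sa u) + κ * (2 * ‖B‖ * (1 + S1 u))) := by
      refine intervalIntegral.integral_mono_on hs0
        (((hcontsum X).mono (hsubI s hs)).intervalIntegrable)
        ((hFc.const_mul _).intervalIntegrable 0 s) fun u hu => ?_
      have hu' : u ∈ Icc 0 T := ⟨hu.1, hu.2.trans hs.2⟩
      have hw : 0 ≤ 2 * ‖B‖ * (ι + Sa u + κ * S1 u) :=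
        mul_nonneg h2B (add_nonneg (add_nonneg hι0 (hSa0 u hu.1)) (mul_nonneg hκ (hS10 u hu.1)))
      calc _ ≤ ∑ Z ∈ univ.filter (fun Z : Finset Λ => ¬ Disjoint Z X),
            ((#Z : ℝ) * ‖Ψ u Z‖ * (2 * ‖B‖ * (ι + Sa u + κ * S1 u)) +
              2 * ‖B‖ * ‖(if R Z then (0 : Op Λ q) else Ψ u Z)‖) := by
            refine sum_le_sum fun Z hZ => ?_
            by_cases hRZ : R Z
            · refine (hterm u hu Z hZ hRZ).trans ?_
              simp only [if_pos hRZ, norm_zero, mul_zero, add_zero, le_refl]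
            · calc _ ≤ 2 * ‖(U u)ᴴ * Ψ u Z * U u‖ * ‖B‖ := norm_commutator_le _ _
                _ = 2 * ‖B‖ * ‖(if R Z then (0 : Op Λ q) else Ψ u Z)‖ := by
                    rw [hnormα u hu', if_neg hRZ]; ring
                _ ≤ _ := le_add_of_nonneg_left (mul_nonneg (mul_nonneg (Nat.cast_nonneg _)
                    (norm_nonneg _)) hw)
        _ = (∑ Z ∈ univ.filter (fun Z : Finset Λ => ¬ Disjoint Z X), (#Z : ℝ) * ‖Ψ u Z‖) *
              (2 * ‖B‖ * (ι + Sa u + κ * S1 u)) +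
            2 * ‖B‖ * ∑ Z ∈ univ.filter (fun Z : Finset Λ => ¬ Disjoint Z X),
              ‖(if R Z then (0 : Op Λ q) else Ψ u Z)‖ := by
            rw [sum_add_distrib, sum_mul, mul_sum]
        _ ≤ (#X * J) * (2 * ‖B‖ * (ι + Sa u + κ * S1 u)) + 2 * ‖B‖ * (#X * (κ * J)) :=
            add_le_add (mul_le_mul_of_nonneg_right (hsumXw u hu' X) hw)
              (mul_le_mul_of_nonneg_left (hsumX' u hu' X) h2B)
        _ = (#X * J) * (2 * ‖B‖ * (ι + Sa u) + κ * (2 * ‖B‖ * (1 + S1 u))) := by ring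
    -- evaluate the integral
    set T₁ : ℝ := s * ι +
      (∑ n ∈ Finset.Icc a N, c ^ n * s ^ (n + 1) / (n + 1)! + c ^ (N + 1) * s ^ (N + 2) / (N + 2)!)
      with hT₁
    set T₂ : ℝ := s * (1 : ℝ) +
      (∑ n ∈ Finset.Icc 1 N, c ^ n * s ^ (n + 1) / (n + 1)! + c ^ (N + 1) * s ^ (N + 2) / (N + 2)!)
      with hT₂
    have hI1 : ∫ u in (0:ℝ)..s, 2 * ‖B‖ * (ι + Sa u) = 2 * ‖B‖ * T₁ := by
      rw [hSa, hT₁]; exact integral_iterBound c s (2 * ‖B‖) ι a N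
    have hI2 : ∫ u in (0:ℝ)..s, 2 * ‖B‖ * (1 + S1 u) = 2 * ‖B‖ * T₂ := by
      rw [hS1, hT₂]; exact integral_iterBound c s (2 * ‖B‖) 1 1 N
    have hi1 : IntervalIntegrable (fun u => 2 * ‖B‖ * (ι + Sa u)) volume 0 s :=
      (by fun_prop : Continuous fun u => 2 * ‖B‖ * (ι + Sa u)).intervalIntegrable 0 s
    have hi2 : IntervalIntegrable (fun u => κ * (2 * ‖B‖ * (1 + S1 u))) volume 0 s :=
      (by fun_prop : Continuous fun u => κ * (2 * ‖B‖ * (1 + S1 u))).intervalIntegrable 0 s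
    have heval : ∫ u in (0:ℝ)..s, (#X * J) * (2 * ‖B‖ * (ι + Sa u) + κ * (2 * ‖B‖ * (1 + S1 u))) =
        (#X * J) * (2 * ‖B‖ * T₁ + κ * (2 * ‖B‖ * T₂)) := by
      rw [intervalIntegral.integral_const_mul, intervalIntegral.integral_add hi1 hi2, hI1,
        intervalIntegral.integral_const_mul, hI2]
    rw [heval] at hint
    -- `c T₁ ≤ S_{N+1}(δX)`, `c T₂ ≤ S_{N+1}(1)`
    have hpow : ∀ n : ℕ, c * (c ^ n * s ^ (n + 1) / (n + 1)!) = (c * s) ^ (n + 1) / (n + 1)! := by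
      intro n; rw [mul_pow]; ring
    have hcT₁ : c * T₁ ≤ ∑ n ∈ Finset.Icc (max 1 (δ X)) (N + 1), (c * s) ^ n / n ! +
        (c * s) ^ (N + 2) / (N + 2)! := by
      have hre := mul_indicator_add_sum_Icc_le (c * s) (δ X) N
      rw [hT₁, mul_add, mul_add, mul_sum]
      simp only [hpow, ← add_assoc]
      refine add_le_add ?_ le_rfl
      rw [show c * (s * ι) = c * s * ι by ring, hι, ha]
      exact hre
    have hcT₂ : c * T₂ ≤ ∑ n ∈ Finset.Icc (max 1 1) (N + 1), (c * s) ^ n / n ! +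
        (c * s) ^ (N + 2) / (N + 2)! := by
      have hre := mul_indicator_add_sum_Icc_le (c * s) 1 N
      simp only [le_refl, if_true, Nat.sub_self] at hre
      rw [show max 1 0 = 1 from rfl] at hre
      rw [hT₂, mul_add, mul_add, mul_sum]
      simp only [hpow, ← add_assoc]
      refine add_le_add ?_ le_rfl
      rw [show c * (s * (1:ℝ)) = c * s * 1 by ring]
      exact hre
    have h1 := hinit X A hA
    have hXV : (0 : ℝ) ≤ #X := Nat.cast_nonneg _
    -- assemble
    have hrhs : 2 * ‖A‖ * ((#X * J) * (2 * ‖B‖ * T₁ + κ * (2 * ‖B‖ * T₂))) =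
        2 * ‖A‖ * ‖B‖ * ((#X : ℝ) * (c * T₁ + κ * (c * T₂))) := by
      rw [hc]; ring
    have hA2 : 0 ≤ 2 * ‖A‖ := by positivity
    have hAB : 0 ≤ 2 * ‖A‖ * ‖B‖ := by positivity
    calc _ ≤ ‖A * B - B * A‖ + 2 * ‖A‖ * ((#X * J) * (2 * ‖B‖ * T₁ + κ * (2 * ‖B‖ * T₂))) :=
          hcore.trans (add_le_add le_rfl (mul_le_mul_of_nonneg_left hint hA2))
      _ ≤ 2 * ‖A‖ * ‖B‖ * (if δ X = 0 then 1 else 0) +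
          2 * ‖A‖ * ‖B‖ * ((#X : ℝ) * (c * T₁ + κ * (c * T₂))) := by
          rw [hrhs]; exact add_le_add h1 le_rfl
      _ ≤ 2 * ‖A‖ * ‖B‖ * (if δ X = 0 then 1 else 0) + 2 * ‖A‖ * ‖B‖ * ((#X : ℝ) *
          ((∑ n ∈ Finset.Icc (max 1 (δ X)) (N + 1), (c * s) ^ n / n ! + (c * s) ^ (N + 2) / (N + 2)!) +
           κ * (∑ n ∈ Finset.Icc (max 1 1) (N + 1), (c * s) ^ n / n ! +
            (c * s) ^ (N + 2) / (N + 2)!))) :=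
          add_le_add le_rfl (mul_le_mul_of_nonneg_left (mul_le_mul_of_nonneg_left
            (add_le_add hcT₁ (mul_le_mul_of_nonneg_left hcT₂ hκ)) hXV) hAB)
      _ = _ := by rw [← mul_add]

/-- **Lieb–Robinson bound for the flow of a quasi-local time-dependent generator (weighted
two-scale form).** Under the hypotheses of `norm_comm_flow_le_iterate_weighted`, for `A ∈ 𝔄_X`
with `δ X ≥ 1`, `0 ≤ μ`, `s ∈ [0, T]`:
`‖[α_s(A), B]‖ ≤ 2‖A‖‖B‖ #X (exp(−μ δX + 2e^μ Js) + κ exp(2Js))`, with `J` the bound of the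
size-weighted local norm. After BMNS 2011 Thm 4.6 and MZ13 §5.2 Lemma 2. [folklore] -/
theorem norm_comm_flow_le_exp_weighted {Ψ : ℝ → Interaction Λ q} (hΨ : ∀ s, (Ψ s).IsLocal)
    {T : ℝ} (hΨc : ∀ Z, ContinuousOn (fun s => Ψ s Z) (Icc 0 T)) {U : ℝ → Op Λ q} (hU0 : U 0 = 1)
    (hU : ∀ s ∈ Icc 0 T,
      HasDerivWithinAt U (((I : ℂ) • localHamiltonian (Ψ s) univ) * U s) (Icc 0 T) s)
    (hU1 : ∀ s ∈ Icc 0 T, (U s)ᴴ * U s = 1) (hU2 : ∀ s ∈ Icc 0 T, U s * (U s)ᴴ = 1)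
    {R : Finset Λ → Prop} [DecidablePred R]
    {X Y : Finset Λ} {A B : Op Λ q} (hA : IsSupportedOn A X) (hB : IsSupportedOn B Y)
    (δ : Finset Λ → ℕ) (hδY : ∀ Z, 0 < δ Z → Disjoint Z Y)
    (hδ : ∀ Z Z', R Z' → ¬ Disjoint Z' Z → δ Z ≤ δ Z' + 1) (hX : 0 < δ X) {J : ℝ} (hJ0 : 0 ≤ J)
    (hJ : ∀ s ∈ Icc 0 T, ∀ x : Λ, ∑ Z ∈ univ.filter (fun Z : Finset Λ => x ∈ Z),
      (#Z : ℝ) * ‖Ψ s Z‖ ≤ J)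
    {κ : ℝ} (hκ : 0 ≤ κ)
    (hJ' : ∀ s ∈ Icc 0 T, ∀ x : Λ, ∑ Z ∈ univ.filter (fun Z : Finset Λ => x ∈ Z),
      ‖(if R Z then (0 : Op Λ q) else Ψ s Z)‖ ≤ κ * J)
    {μ : ℝ} (hμ : 0 ≤ μ) {s : ℝ} (hs : s ∈ Icc 0 T) :
    ‖(U s)ᴴ * A * U s * B - B * ((U s)ᴴ * A * U s)‖ ≤
      2 * ‖A‖ * ‖B‖ * #X * (Real.exp (-(μ * δ X) + 2 * Real.exp μ * J * s) +
        κ * Real.exp (2 * J * s)) := by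
  set c : ℝ := 2 * J with hc
  have hc0 : 0 ≤ c := by rw [hc]; positivity
  have hcs : 0 ≤ c * s := mul_nonneg hc0 hs.1
  set L : ℝ := ‖(U s)ᴴ * A * U s * B - B * ((U s)ᴴ * A * U s)‖ with hL
  have hN : ∀ N : ℕ, L ≤ 2 * ‖A‖ * ‖B‖ * ((#X : ℝ) *
      ((Real.exp (-(μ * δ X)) * Real.exp (Real.exp μ * (c * s)) + (c * s) ^ (N + 1) / (N + 1)!) +
        κ * (Real.exp (c * s) + (c * s) ^ (N + 1) / (N + 1)!))) := by
    intro N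
    have h := norm_comm_flow_le_iterate_weighted hΨ hΨc hU0 hU hU1 hU2 hB δ hδY hδ hJ0 hJ hκ hJ'
      N X A hA s hs
    rw [if_neg (Nat.pos_iff_ne_zero.mp hX), zero_add, ← hc,
      show max 1 (δ X) = δ X from max_eq_right hX, show max 1 1 = 1 from max_self 1] at h
    refine h.trans (mul_le_mul_of_nonneg_left (mul_le_mul_of_nonneg_left
      (add_le_add (add_le_add ?_ le_rfl) (mul_le_mul_of_nonneg_left (add_le_add ?_ le_rfl) hκ))
      (by positivity)) (by positivity))
    · exact sum_Icc_pow_div_factorial_le hcs hμ (δ X) N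
    · have h1 := sum_Icc_pow_div_factorial_le hcs le_rfl 1 N
      simpa using h1
  have hlim : Tendsto (fun N : ℕ => 2 * ‖A‖ * ‖B‖ * ((#X : ℝ) *
      ((Real.exp (-(μ * δ X)) * Real.exp (Real.exp μ * (c * s)) + (c * s) ^ (N + 1) / (N + 1)!) +
        κ * (Real.exp (c * s) + (c * s) ^ (N + 1) / (N + 1)!)))) atTop
      (𝓝 (2 * ‖A‖ * ‖B‖ * ((#X : ℝ) *
        ((Real.exp (-(μ * δ X)) * Real.exp (Real.exp μ * (c * s)) + 0) +
          κ * (Real.exp (c * s) + 0))))) := by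
    have h0 : Tendsto (fun N : ℕ => (c * s) ^ (N + 1) / (N + 1)!) atTop (𝓝 0) :=
      (FloorSemiring.tendsto_pow_div_factorial_atTop (c * s)).comp (tendsto_add_atTop_nat 1)
    exact tendsto_const_nhds.mul (tendsto_const_nhds.mul ((tendsto_const_nhds.add h0).add
      (tendsto_const_nhds.mul (tendsto_const_nhds.add h0))))
  have hle := ge_of_tendsto' hlim hN
  rw [add_zero, add_zero] at hle
  refine hle.trans (le_of_eq ?_)
  rw [Real.exp_add, hc]
  ring_nf

end Lattice

end Literature.MathematicalPhysics.QuantumLattice
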